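import Summits.MatrixMultiplication.OmegaCensus.STPPKernelListerCapstone2
import Summits.MatrixMultiplication.OmegaCensus.STPPKernelListerDeadZ61B
import Summits.MatrixMultiplication.OmegaCensus.STPPKernelListerRowsZ61S1
import Summits.MatrixMultiplication.OmegaCensus.STPPKernelListerRowsZ61S2
import Summits.MatrixMultiplication.OmegaCensus.STPPKernelListerRowsZ61S3
import Summits.MatrixMultiplication.OmegaCensus.STPPKernelListerRowsZ61S4
import Summits.MatrixMultiplication.OmegaCensus.STPPKernelListerRowsZ61S5
import Summits.MatrixMultiplication.OmegaCensus.STPPKernelListerRowsZ61S6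
import Summits.MatrixMultiplication.OmegaCensus.STPPKernelListerRowsZ61S7
import Summits.MatrixMultiplication.OmegaCensus.STPPKernelListerRowsZ61S8
import Summits.MatrixMultiplication.OmegaCensus.STPPKernelListerRowsZ61S9
import Summits.MatrixMultiplication.OmegaCensus.STPPKernelListerRowsZ61S10
import Summits.MatrixMultiplication.OmegaCensus.STPPKernelListerRowsZ61S11
import Summits.MatrixMultiplication.OmegaCensus.STPPKernelListerRowsZ61S12
import Summits.MatrixMultiplication.OmegaCensus.STPPKernelListerRowsZ61S13
import Summits.MatrixMultiplication.OmegaCensus.STPPKernelListerRowsZ61S14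
import Summits.MatrixMultiplication.OmegaCensus.STPPKernelListerRowsZ61S15
import Summits.MatrixMultiplication.OmegaCensus.STPPKernelListerRowsZ61S16
import Summits.MatrixMultiplication.OmegaCensus.STPPKernelListerRowsZ61S17
import Summits.MatrixMultiplication.OmegaCensus.STPPKernelListerRowsZ61S18
import Summits.MatrixMultiplication.OmegaCensus.STPPKernelListerRowsZ61S19
import Summits.MatrixMultiplication.OmegaCensus.STPPKernelListerRowsZ61S20
import Summits.MatrixMultiplication.OmegaCensus.STPPKernelListerRowsZ61S21P1
import Summits.MatrixMultiplication.OmegaCensus.STPPKernelListerRowsZ61S21P2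
import Summits.MatrixMultiplication.OmegaCensus.STPPKernelListerRowsZ61S21P3
import Summits.MatrixMultiplication.OmegaCensus.STPPKernelListerRowsZ61S21P4
import Summits.MatrixMultiplication.OmegaCensus.STPPKernelListerRowsZ61S21P5
import Summits.MatrixMultiplication.OmegaCensus.STPPKernelListerRowsZ61S21P6
import Summits.MatrixMultiplication.OmegaCensus.STPPKernelListerRowsZ61S21P7
import Summits.MatrixMultiplication.OmegaCensus.STPPKernelListerRowsZ61S21P8
import Summits.MatrixMultiplication.OmegaCensus.STPPKernelListerRowsZ61S22
import Summits.MatrixMultiplication.OmegaCensus.STPPKernelListerRowsZ61S23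
import Summits.MatrixMultiplication.OmegaCensus.STPPKernelListerRowsZ61S24
import Summits.MatrixMultiplication.OmegaCensus.STPPKernelListerRowsZ61S25
import Summits.MatrixMultiplication.OmegaCensus.STPPKernelListerRowsZ61S26
import Summits.MatrixMultiplication.OmegaCensus.STPPKernelListerRowsZ61S27
import Summits.MatrixMultiplication.OmegaCensus.STPPKernelListerRowsZ61S28
import Summits.MatrixMultiplication.OmegaCensus.STPPKernelListerRowsZ61S29
import Summits.MatrixMultiplication.OmegaCensus.STPPKernelListerRowsZ61S30
import Summits.MatrixMultiplication.OmegaCensus.STPPKernelListerRowsZ61S31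
import Summits.MatrixMultiplication.OmegaCensus.STPPKernelListerRowsZ61S32
import Summits.MatrixMultiplication.OmegaCensus.STPPKernelListerRowsZ61S33
import Summits.MatrixMultiplication.OmegaCensus.STPPKernelListerRowsZ61S34
import Summits.MatrixMultiplication.OmegaCensus.STPPKernelListerRowsZ61S35
import Summits.MatrixMultiplication.OmegaCensus.STPPKernelListerRowsZ61S36
import Summits.MatrixMultiplication.OmegaCensus.STPPKernelListerRowsZ61S37
import Summits.MatrixMultiplication.OmegaCensus.STPPKernelListerRowsZ61S38
import Summits.MatrixMultiplication.OmegaCensus.STPPKernelListerRowsZ61S39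
import Summits.MatrixMultiplication.OmegaCensus.STPPKernelListerRowsZ61S40
import Summits.MatrixMultiplication.OmegaCensus.STPPKernelListerRowsZ61S41
import Summits.MatrixMultiplication.OmegaCensus.STPPKernelListerRowsZ61S42
import Summits.MatrixMultiplication.OmegaCensus.STPPKernelListerRowsZ61S43
import Summits.MatrixMultiplication.OmegaCensus.STPPKernelListerRowsZ61S44
import Summits.MatrixMultiplication.OmegaCensus.STPPKernelListerRowsZ61S45
import Summits.MatrixMultiplication.OmegaCensus.STPPKernelListerRowsZ61S46
import Summits.MatrixMultiplication.OmegaCensus.STPPKernelListerRowsZ61S47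
import Summits.MatrixMultiplication.OmegaCensus.STPPKernelListerRowsZ61S48
import Summits.MatrixMultiplication.OmegaCensus.STPPKernelListerRowsZ61S49
import Summits.MatrixMultiplication.OmegaCensus.STPPKernelListerRowsZ61S50
import Summits.MatrixMultiplication.OmegaCensus.STPPKernelListerRowsZ61S51
import Summits.MatrixMultiplication.OmegaCensus.STPPKernelListerRowsZ61S52
import Summits.MatrixMultiplication.OmegaCensus.STPPKernelListerRowsZ61S53
import Summits.MatrixMultiplication.OmegaCensus.STPPKernelListerRowsZ61S54
import Summits.MatrixMultiplication.OmegaCensus.STPPKernelListerRowsZ61S55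
import Summits.MatrixMultiplication.OmegaCensus.STPPKernelListerRowsZ61S56
import Summits.MatrixMultiplication.OmegaCensus.STPPKernelListerRowsZ61S57
import Summits.MatrixMultiplication.OmegaCensus.STPPKernelListerRowsZ61S58
import Summits.MatrixMultiplication.OmegaCensus.STPPKernelListerRowsZ61S59
import Summits.MatrixMultiplication.OmegaCensus.STPPKernelListerRowsZ61S60
import Summits.MatrixMultiplication.OmegaCensus.STPPKernelListerRowsZ61S61
import Summits.MatrixMultiplication.OmegaCensus.STPPKernelListerRowsZ61S62
import Summits.MatrixMultiplication.OmegaCensus.STPPKernelListerRowsZ61S63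
import Summits.MatrixMultiplication.OmegaCensus.STPPKernelListerRowsZ61S64
import Summits.MatrixMultiplication.OmegaCensus.STPPKernelListerRowsZ61S65
import Summits.MatrixMultiplication.OmegaCensus.STPPKernelListerRowsZ61S66
import Summits.MatrixMultiplication.OmegaCensus.STPPKernelListerRowsZ61S67
import Summits.MatrixMultiplication.OmegaCensus.STPPKernelListerRowsZ61S68
import Summits.MatrixMultiplication.OmegaCensus.STPPKernelListerRowsZ61S69
import Summits.MatrixMultiplication.OmegaCensus.STPPKernelListerRowsZ61S70
import Summits.MatrixMultiplication.OmegaCensus.STPPKernelListerRowsZ61S71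
import Summits.MatrixMultiplication.OmegaCensus.STPPKernelListerRowsZ61S72
import Summits.MatrixMultiplication.OmegaCensus.STPPKernelListerRowsZ61S73
import Summits.MatrixMultiplication.OmegaCensus.STPPKernelListerRowsZ61S74

/-!
# ω-census (abelian STPP census): **ℤ₆₁ admits no beating STPP family — KERNEL** (capstone of the kernel lister)

HONEST FRAMING (pub-omega census; verbatim): lottery ticket; floor = certified bounds/negative ranges.
Census STRUCTURE (seat pub-omega-stpp-2 gen 29, 2026-08-29), family (b2).  Nothing here is progress on `ω`: the theorem says that the cyclic group of
order 61 yields NO upper bound on `ω` below 3 through CKSU Thm. 5.5 with simultaneous-triple-product families, whatever the number of triples.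
`volume_le_card_zmod61` — inputs: `volume_le_of_scan2` (`STPPKernelListerCapstone2.lean`), the certified tables and dead list (`…DataZ61`), the 74 split row
files `…RowsZ61S1–S74`, and the 54 non-realisability theorems (`…DeadZ61A/B`).
-/

open Finset

namespace Summit.MatrixMultiplication.OmegaCensus.KLister

open Literature.Computability.AlgebraicComplexity

/-- Every listed shape of order `61` is admissible. [folklore] -/
theorem adm_flat_chunksZ61 : ((flat chunksZ61).all (adm 61)) = true := by
  decide +kernel

/-- Every admissible shape of order `61` is listed. [folklore] -/
theorem mem_flat_chunksZ61 (s : Shape) (hs : adm 61 s = true) : s ∈ flat chunksZ61 := by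
  have e : flat chunksZ61 = shapeList 61 := chunksZ61_shapes
  rw [e]; exact mem_shapeList_of_adm hs

/-- The dead list of order `61` consists of non-realisable patterns. [folklore] -/
theorem deadZ61_notRealizable : ∀ D ∈ deadZ61, ¬ Realizable (ZMod 61) D := by
  intro D hD
  unfold deadZ61 at hD
  exact notRealizable_deadZ61 D hD

/-- The certificates (first-block selection, second-block selection) of the split root computation at `61`. [folklore] -/
def certsZ61 : List ((Shape → Bool) × (Shape → Bool)) :=
  [((fun s => sel1Z61S1.contains s), (fun _ => true)),
   ((fun s => sel1Z61S2.contains s), (fun _ => true)),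
   ((fun s => sel1Z61S3.contains s), (fun _ => true)),
   ((fun s => sel1Z61S4.contains s), (fun _ => true)),
   ((fun s => sel1Z61S5.contains s), (fun _ => true)),
   ((fun s => sel1Z61S6.contains s), (fun _ => true)),
   ((fun s => sel1Z61S7.contains s), (fun _ => true)),
   ((fun s => sel1Z61S8.contains s), (fun _ => true)),
   ((fun s => sel1Z61S9.contains s), (fun _ => true)),
   ((fun s => sel1Z61S10.contains s), (fun _ => true)),
   ((fun s => sel1Z61S11.contains s), (fun _ => true)),
   ((fun s => sel1Z61S12.contains s), (fun _ => true)),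
   ((fun s => sel1Z61S13.contains s), (fun _ => true)),
   ((fun s => sel1Z61S14.contains s), (fun _ => true)),
   ((fun s => sel1Z61S15.contains s), (fun _ => true)),
   ((fun s => sel1Z61S16.contains s), (fun _ => true)),
   ((fun s => sel1Z61S17.contains s), (fun _ => true)),
   ((fun s => sel1Z61S18.contains s), (fun _ => true)),
   ((fun s => sel1Z61S19.contains s), (fun _ => true)),
   ((fun s => sel1Z61S20.contains s), (fun _ => true)),
   ((fun s => sel1Z61S21P1.contains s), (fun _ => true)),
   ((fun s => sel1Z61S21P2.contains s), (fun _ => true)),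
   ((fun s => sel1Z61S21P3.contains s), (fun _ => true)),
   ((fun s => sel1Z61S21P4.contains s), (fun _ => true)),
   ((fun s => sel1Z61S21P5.contains s), (fun _ => true)),
   ((fun s => sel1Z61S21P6.contains s), (fun _ => true)),
   ((fun s => sel1Z61S21P7.contains s), (fun _ => true)),
   ((fun s => sel1Z61S21P8.contains s), (fun _ => true)),
   ((fun s => sel1Z61S22.contains s), (fun t => (fun t => sel2Z61S22.contains t) t || (fun t => (fun t => sel2Z61S23.contains t) t || (fun t => !(sel2Z61S22.contains t || sel2Z61S23.contains t)) t) t)),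
   ((fun s => sel1Z61S25.contains s), (fun t => (fun t => sel2Z61S25.contains t) t || (fun t => !(sel2Z61S25.contains t)) t)),
   ((fun s => sel1Z61S27.contains s), (fun t => (fun t => sel2Z61S27.contains t) t || (fun t => !(sel2Z61S27.contains t)) t)),
   ((fun s => sel1Z61S29.contains s), (fun t => (fun t => sel2Z61S29.contains t) t || (fun t => !(sel2Z61S29.contains t)) t)),
   ((fun s => sel1Z61S31.contains s), (fun t => (fun t => sel2Z61S31.contains t) t || (fun t => !(sel2Z61S31.contains t)) t)),
   ((fun s => sel1Z61S33.contains s), (fun t => (fun t => sel2Z61S33.contains t) t || (fun t => !(sel2Z61S33.contains t)) t)),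
   ((fun s => sel1Z61S35.contains s), (fun t => (fun t => sel2Z61S35.contains t) t || (fun t => !(sel2Z61S35.contains t)) t)),
   ((fun s => sel1Z61S37.contains s), (fun t => (fun t => sel2Z61S37.contains t) t || (fun t => !(sel2Z61S37.contains t)) t)),
   ((fun s => sel1Z61S39.contains s), (fun t => (fun t => sel2Z61S39.contains t) t || (fun t => !(sel2Z61S39.contains t)) t)),
   ((fun s => sel1Z61S41.contains s), (fun t => (fun t => sel2Z61S41.contains t) t || (fun t => (fun t => sel2Z61S42.contains t) t || (fun t => !(sel2Z61S41.contains t || sel2Z61S42.contains t)) t) t)),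
   ((fun s => sel1Z61S44.contains s), (fun t => (fun t => sel2Z61S44.contains t) t || (fun t => (fun t => sel2Z61S45.contains t) t || (fun t => !(sel2Z61S44.contains t || sel2Z61S45.contains t)) t) t)),
   ((fun s => sel1Z61S47.contains s), (fun t => (fun t => sel2Z61S47.contains t) t || (fun t => (fun t => sel2Z61S48.contains t) t || (fun t => !(sel2Z61S47.contains t || sel2Z61S48.contains t)) t) t)),
   ((fun s => sel1Z61S50.contains s), (fun t => (fun t => sel2Z61S50.contains t) t || (fun t => (fun t => sel2Z61S51.contains t) t || (fun t => (fun t => sel2Z61S52.contains t) t || (fun t => !(sel2Z61S50.contains t || sel2Z61S51.contains t || sel2Z61S52.contains t)) t) t) t)),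
   ((fun s => sel1Z61S54.contains s), (fun t => (fun t => sel2Z61S54.contains t) t || (fun t => (fun t => sel2Z61S55.contains t) t || (fun t => !(sel2Z61S54.contains t || sel2Z61S55.contains t)) t) t)),
   ((fun s => sel1Z61S57.contains s), (fun t => (fun t => sel2Z61S57.contains t) t || (fun t => (fun t => sel2Z61S58.contains t) t || (fun t => !(sel2Z61S57.contains t || sel2Z61S58.contains t)) t) t)),
   ((fun s => sel1Z61S60.contains s), (fun t => (fun t => sel2Z61S60.contains t) t || (fun t => (fun t => sel2Z61S61.contains t) t || (fun t => !(sel2Z61S60.contains t || sel2Z61S61.contains t)) t) t)),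
   ((fun s => sel1Z61S63.contains s), (fun t => (fun t => sel2Z61S63.contains t) t || (fun t => (fun t => sel2Z61S64.contains t) t || (fun t => !(sel2Z61S63.contains t || sel2Z61S64.contains t)) t) t)),
   ((fun s => sel1Z61S66.contains s), (fun t => (fun t => sel2Z61S66.contains t) t || (fun t => !(sel2Z61S66.contains t)) t)),
   ((fun s => sel1Z61S68.contains s), (fun t => (fun t => sel2Z61S68.contains t) t || (fun t => (fun t => sel2Z61S69.contains t) t || (fun t => !(sel2Z61S68.contains t || sel2Z61S69.contains t)) t) t)),
   ((fun s => sel1Z61S71.contains s), (fun t => (fun t => sel2Z61S71.contains t) t || (fun t => !(sel2Z61S71.contains t)) t)),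
   ((fun s => sel1Z61S73.contains s), (fun t => (fun t => sel2Z61S73.contains t) t || (fun t => !(sel2Z61S73.contains t)) t))]

/-- Every listed shape is the first block of some certificate. [folklore] -/
theorem certsZ61_cover : ((flat chunksZ61).all fun s => certsZ61.any fun c => c.1 s) = true := by
  decide +kernel

/-- Every certificate: its second-block selection covers all shapes, and its split computation returns `true`. [folklore] -/
theorem certsZ61_scan : ∀ c ∈ certsZ61, (∀ x ∈ flat chunksZ61, c.2 x = true) ∧ scanFirstSel2C 61 deadZ61 c.1 c.2 chunksZ61 = true := by
  intro c hc
  simp only [certsZ61, List.mem_cons, List.not_mem_nil, or_false] at hc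
  rcases hc with rfl | rfl | rfl | rfl | rfl | rfl | rfl | rfl | rfl | rfl | rfl | rfl | rfl | rfl | rfl | rfl | rfl | rfl | rfl | rfl | rfl | rfl | rfl | rfl | rfl | rfl | rfl | rfl | rfl | rfl | rfl | rfl | rfl | rfl | rfl | rfl | rfl | rfl | rfl | rfl | rfl | rfl | rfl | rfl | rfl | rfl | rfl | rfl | rfl
  exacts [⟨fun _ _ => rfl, scanSel_Z61_S1⟩, ⟨fun _ _ => rfl, scanSel_Z61_S2⟩, ⟨fun _ _ => rfl, scanSel_Z61_S3⟩, ⟨fun _ _ => rfl, scanSel_Z61_S4⟩, ⟨fun _ _ => rfl, scanSel_Z61_S5⟩, ⟨fun _ _ => rfl, scanSel_Z61_S6⟩, ⟨fun _ _ => rfl, scanSel_Z61_S7⟩, ⟨fun _ _ => rfl, scanSel_Z61_S8⟩, ⟨fun _ _ => rfl, scanSel_Z61_S9⟩, ⟨fun _ _ => rfl, scanSel_Z61_S10⟩, ⟨fun _ _ => rfl, scanSel_Z61_S11⟩, ⟨fun _ _ => rfl, scanSel_Z61_S12⟩, ⟨fun _ _ => rfl, scanSel_Z61_S13⟩, ⟨fun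 _ _ => rfl, scanSel_Z61_S14⟩, ⟨fun _ _ => rfl, scanSel_Z61_S15⟩, ⟨fun _ _ => rfl, scanSel_Z61_S16⟩, ⟨fun _ _ => rfl, scanSel_Z61_S17⟩, ⟨fun _ _ => rfl, scanSel_Z61_S18⟩, ⟨fun _ _ => rfl, scanSel_Z61_S19⟩, ⟨fun _ _ => rfl, scanSel_Z61_S20⟩, ⟨fun _ _ => rfl, scanSel_Z61_S21P1⟩, ⟨fun _ _ => rfl, scanSel_Z61_S21P2⟩, ⟨fun _ _ => rfl, scanSel_Z61_S21P3⟩, ⟨fun _ _ => rfl, scanSel_Z61_S21P4⟩, ⟨fun _ _ => rfl, scanSel_Z61_S21P5⟩, ⟨fun _ _ => rfl, scanSel_Z61_S21P6⟩, ⟨fun _ _ => rfl, scanSel_Z61_S21P7⟩, ⟨fun _ _ => rfl, scanSel_Z61_S21P8⟩, ⟨fun x _ => by dsimp only; generalize sel2Z61S22.contains x = b0; generalize sel2Z61S23.contains x = b1; cases b0 <;> cases b1 <;> rfl, (scanFirstSel2C_or2 chunksZ61 scanSel_Z61_S22 (scanFirstSel2C_or2 chunksZ61 scanSel_Z61_S23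 scanSel_Z61_S24))⟩, ⟨fun x _ => by dsimp only; generalize sel2Z61S25.contains x = b0; cases b0 <;> rfl, (scanFirstSel2C_or2 chunksZ61 scanSel_Z61_S25 scanSel_Z61_S26)⟩, ⟨fun x _ => by dsimp only; generalize sel2Z61S27.contains x = b0; cases b0 <;> rfl, (scanFirstSel2C_or2 chunksZ61 scanSel_Z61_S27 scanSel_Z61_S28)⟩, ⟨fun x _ => by dsimp only; generalize sel2Z61S29.contains x = b0; cases b0 <;> rfl, (scanFirstSel2C_or2 chunksZ61 scanSel_Z61_S29 scanSel_Z61_S30)⟩, ⟨fun x _ => by dsimp only; generalize sel2Z61S31.contains x = b0; cases b0 <;> rfl, (scanFirstSel2C_or2 chunksZ61 scanSel_Z61_S31 scanSel_Z61_S32)⟩, ⟨fun x _ => by dsimp only; generalize sel2Z61S33.contains x = b0; cases b0 <;> rfl, (scanFirstSel2C_or2 chunksZ61 scanSel_Z61_S33 scanSel_Z61_S34)⟩, ⟨fun x _ => by dsimp only; generalize sel2Z61S35.contains x = b0; cases b0 <;> rfl, (scanFirstSel2C_or2 chunksZ61 scanSel_Z61_S35 scanSel_Z61_S36)⟩, ⟨fun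 x _ => by dsimp only; generalize sel2Z61S37.contains x = b0; cases b0 <;> rfl, (scanFirstSel2C_or2 chunksZ61 scanSel_Z61_S37 scanSel_Z61_S38)⟩, ⟨fun x _ => by dsimp only; generalize sel2Z61S39.contains x = b0; cases b0 <;> rfl, (scanFirstSel2C_or2 chunksZ61 scanSel_Z61_S39 scanSel_Z61_S40)⟩, ⟨fun x _ => by dsimp only; generalize sel2Z61S41.contains x = b0; generalize sel2Z61S42.contains x = b1; cases b0 <;> cases b1 <;> rfl, (scanFirstSel2C_or2 chunksZ61 scanSel_Z61_S41 (scanFirstSel2C_or2 chunksZ61 scanSel_Z61_S42 scanSel_Z61_S43))⟩, ⟨fun x _ => by dsimp only; generalize sel2Z61S44.contains x = b0; generalize sel2Z61S45.contains x = b1; cases b0 <;> cases b1 <;> rfl, (scanFirstSel2C_or2 chunksZ61 scanSel_Z61_S44 (scanFirstSel2C_or2 chunksZ61 scanSel_Z61_S45 scanSel_Z61_S46))⟩, ⟨fun x _ => by dsimp only; generalize sel2Z61S47.contains x = b0; generalize sel2Z61S48.contains x = b1; cases b0 <;> cases b1 <;> rfl, (scanFirstSel2C_or2 chunksZ61 scanSel_Z61_S47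 (scanFirstSel2C_or2 chunksZ61 scanSel_Z61_S48 scanSel_Z61_S49))⟩, ⟨fun x _ => by dsimp only; generalize sel2Z61S50.contains x = b0; generalize sel2Z61S51.contains x = b1; generalize sel2Z61S52.contains x = b2; cases b0 <;> cases b1 <;> cases b2 <;> rfl, (scanFirstSel2C_or2 chunksZ61 scanSel_Z61_S50 (scanFirstSel2C_or2 chunksZ61 scanSel_Z61_S51 (scanFirstSel2C_or2 chunksZ61 scanSel_Z61_S52 scanSel_Z61_S53)))⟩, ⟨fun x _ => by dsimp only; generalize sel2Z61S54.contains x = b0; generalize sel2Z61S55.contains x = b1; cases b0 <;> cases b1 <;> rfl, (scanFirstSel2C_or2 chunksZ61 scanSel_Z61_S54 (scanFirstSel2C_or2 chunksZ61 scanSel_Z61_S55 scanSel_Z61_S56))⟩, ⟨fun x _ => by dsimp only; generalize sel2Z61S57.contains x = b0; generalize sel2Z61S58.contains x = b1; cases b0 <;> cases b1 <;> rfl, (scanFirstSel2C_or2 chunksZ61 scanSel_Z61_S57 (scanFirstSel2C_or2 chunksZ61 scanSel_Z61_S58 scanSel_Z61_S59))⟩, ⟨fun x _ => by dsimp only; generalize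 sel2Z61S60.contains x = b0; generalize sel2Z61S61.contains x = b1; cases b0 <;> cases b1 <;> rfl, (scanFirstSel2C_or2 chunksZ61 scanSel_Z61_S60 (scanFirstSel2C_or2 chunksZ61 scanSel_Z61_S61 scanSel_Z61_S62))⟩, ⟨fun x _ => by dsimp only; generalize sel2Z61S63.contains x = b0; generalize sel2Z61S64.contains x = b1; cases b0 <;> cases b1 <;> rfl, (scanFirstSel2C_or2 chunksZ61 scanSel_Z61_S63 (scanFirstSel2C_or2 chunksZ61 scanSel_Z61_S64 scanSel_Z61_S65))⟩, ⟨fun x _ => by dsimp only; generalize sel2Z61S66.contains x = b0; cases b0 <;> rfl, (scanFirstSel2C_or2 chunksZ61 scanSel_Z61_S66 scanSel_Z61_S67)⟩, ⟨fun x _ => by dsimp only; generalize sel2Z61S68.contains x = b0; generalize sel2Z61S69.contains x = b1; cases b0 <;> cases b1 <;> rfl, (scanFirstSel2C_or2 chunksZ61 scanSel_Z61_S68 (scanFirstSel2C_or2 chunksZ61 scanSel_Z61_S69 scanSel_Z61_S70))⟩, ⟨fun x _ => by dsimp only; generalize sel2Z61S71.contains x = b0; cases b0 <;> rfl, (scanFirstSel2C_or2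 chunksZ61 scanSel_Z61_S71 scanSel_Z61_S72)⟩, ⟨fun x _ => by dsimp only; generalize sel2Z61S73.contains x = b0; cases b0 <;> rfl, (scanFirstSel2C_or2 chunksZ61 scanSel_Z61_S73 scanSel_Z61_S74)⟩]

/-- **CAPSTONE (kernel): no simultaneous-triple-product family of `ℤ₆₁` beats the sum of cubes** — for every `m` and every STPP family
`(Aᵢ, Bᵢ, Cᵢ)_{i<m}` of `ℤ/61` (CKSU Def. 5.1), `Σᵢ |Aᵢ||Bᵢ||Cᵢ| ≤ 61`; hence CKSU Thm. 5.5 gives no bound `ω < 3` from `ℤ₆₁`. [cite: CohnKleinbergSzegedyUmans2005, Def. 5.1, Thm. 5.5] -/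
theorem volume_le_card_zmod61 {m : ℕ} (A B C : Fin m → Finset (ZMod 61)) (hS : IsSTPP A B C) : ∑ i, #(A i) * #(B i) * #(C i) ≤ 61 :=
  volume_le_of_scan2 (H := ZMod 61) (n := 61) (ZMod.card 61) (by norm_num) chunksZ61 deadZ61 certsZ61 deadZ61_notRealizable chunksOK_Z61
    (fun s hs => List.all_eq_true.1 adm_flat_chunksZ61 s hs) mem_flat_chunksZ61
    (fun s hs => by
      have h := List.all_eq_true.1 certsZ61_cover s hs
      obtain ⟨c, hc, h1⟩ := List.any_eq_true.1 h
      exact ⟨c, hc, h1⟩)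
    certsZ61_scan A B C hS

end Summit.MatrixMultiplication.OmegaCensus.KLister
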